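import Summits.PneNP.PneNP.Theses.WitnessForging
import Summits.PneNP.PneNP.Theorems.WitnessForgingCalibrationSatBPPSatTest
import Summits.PneNP.PneNP.Theorems.WitnessForgingCalibrationSatBPPCompact
import Literature.Computability.Complexity.CNFInvariance
import Literature.Computability.Complexity.NPSubsetBPPCollapse
import Literature.Computability.Complexity.CountingHierarchyProofs
import Literature.Computability.Complexity.IndexAllBricks
import Literature.Computability.Complexity.PlumbingBricks
import Literature.Computability.Complexity.KSATReductions
import Literature.Computability.Complexity.CoinBlockRejectionSampling

-- every `Summit.PneNP.PneNP.…` name repeats the summit = sub-problem component (layout D-0017)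
set_option linter.dupNamespace false

/-!
# `SAT ∉ BPP → ForgingThesis`: calibration of the witness-forging thesis from below

Closes the support item `CalibrationSatBPP` (stmt-PneNP-2437) of route `PneNP/WitnessForging`
(`Summit.PneNP.PneNP.Theses.WitnessForging.CalibrationSatBPP`): if `SAT ∉ BPP` then no probabilistic
polynomial-time algorithm `1/4`-forges the uniform measure `μ_φ` on the satisfying assignments of every
satisfiable compactly indexed CNF `φ`. Contrapositive, as in the item text (Goldreich 2001, §2.7.3;
Ko 1982): a forger `A` decides `SAT` with one-sided error — rename the variables of the input formula
compactly, run `A`, accept iff the output satisfies the formula —, so `SAT ∈ RP ⊆ BPP`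
(`RP_subset_BPP_holds`, `ProbabilisticClassesProofs.lean`).

## The witness language and the two points where the typed statement bites

* **The coin budget of `A` is only polynomially BOUNDED** (`RandAlg.IsPolyTime`: `coinLen n ≤ pc n`,
  `coinLen` an arbitrary, possibly non-computable function), while `RP = rp P` samples exactly `q(|x|)`
  coins. The witness language therefore accepts `⟨x, r⟩` iff SOME prefix `r ↾ j`, `j < |⟨x, r⟩|`, makes
  `A(x̂, r ↾ j)` satisfy the compacted code `x̂` — a bounded existential over a `P` test, in `P` by
  `Brick.ballLen_mem_P` (`IndexAllBricks.lean`) and `P = coP` (`compl_mem_P_iff`). For the true budget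
  `m = coinLen |x̂| ≤ pc(s(|x|)) = q(|x|)` (`s` the output-length polynomial of the compaction,
  `exists_poly_length_le_of_mem_FP`; monotonicity `TM2Iter.eval_mono`) the prefix `r ↾ m` of a uniform
  `r ∈ {0,1}^{q(|x|)}` is uniform (`uniformProb_take_of_le`), so the acceptance probability is at least
  `Pr[A(x̂) ∈ supp μ_x̂] ≥ μ_x̂(supp) - 1/4 = 3/4`.
* **Compactness** (`numVars φ ≤ |encode φ|`) is not automatic for binary variable numerals: the input is
  first canonicalised (`KSATRed.canonCNFFn = encode ∘ decCNF`) and compacted by the order-preserving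
  count renaming (`exists_compactFn`, `WitnessForgingCalibrationSatBPPCompact.lean`), which is injective
  on occurring variables (`countRename_injOn`, hence `satisfiable_rename_iff'` by
  `CNF.satisfiable_rename_iff`) and compact (`numVars_rename_le`).

The acceptance test is the strict satisfaction test `exists_satTestFn`
(`WitnessForgingCalibrationSatBPPSatTest.lean`); on the support of `μ_x̂` (strings of length `numVars`)
it agrees with `CNF.eval` (`strictSat_of_eval`, `CNF.lt_numVars_of_mem_of_mem`). Main results:
`CalibrationSatBPP.SAT_mem_RP_of_forger` and `Summit.PneNP.PneNP.Theorems.CalibrationSatBPP_proof`.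

## References

* O. Goldreich, *Foundations of Cryptography I*, CUP 2001, §2.7.3 (`NP ∖ BPP ≠ ∅` and the verified
  output of a probabilistic search) [Goldreich2001FoC1].
* K. Ko, *Some observations on the probabilistic algorithms and NP-hard problems*, Inform. Process.
  Lett. 14 (1982) 39–43 (a probabilistic witness finder gives `RP`) [Ko1982].
* S. Arora, B. Barak, *Computational Complexity: A Modern Approach*, CUP 2009, Def. 7.6 (`RP`), §7.3
  (`RP ⊆ BPP`), §7.1 (coins as a uniform string), §1.3 (closure of polynomial time) [AroraBarakCC2009].
* M. R. Jerrum, L. G. Valiant, V. V. Vazirani, *Random generation of combinatorial structures from a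
  uniform distribution*, TCS 43 (1986) 169–188 (uniform generation vs. decision) [JerrumValiantVazirani1986].
-/

namespace Summit.PneNP.PneNP.Theorems

namespace CalibrationSatBPP

open Literature.Computability.Complexity _root_.Computability Brick Polynomial

/-! ### The count renaming is injective on occurring variables and yields compact formulas -/

/-- Counting below a larger threshold that is passed by an element of the list gives a strictly larger
count: for `v₁ < v₂` with `v₁ ∈ L`, `#{x ∈ L | x < v₁} < #{x ∈ L | x < v₂}`. [folklore] -/
theorem countP_lt_lt_countP_lt {L : List ℕ} {v₁ v₂ : ℕ} (h12 : v₁ < v₂) (hmem : v₁ ∈ L) :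
    L.countP (· < v₁) < L.countP (· < v₂) := by
  induction L with
  | nil => exact absurd hmem List.not_mem_nil
  | cons x L ih =>
    have hmono : L.countP (· < v₁) ≤ L.countP (· < v₂) :=
      List.countP_mono_left fun y _ hy => by
        simp only [decide_eq_true_eq] at hy ⊢; omega
    simp only [List.countP_cons, decide_eq_true_eq]
    rcases List.mem_cons.1 hmem with h | h
    · subst h
      split_ifs <;> omega
    · have := ih h
      split_ifs <;> omega

/-- **The count renaming `v ↦ #{occurrences of variables < v}` is injective on the occurring variables.**
[folklore] -/
theorem countRename_injOn (φ : CNF ℕ) :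
    Set.InjOn (fun v => (φ.flatten.map Prod.fst).countP (· < v)) (φ.vars : Set ℕ) := by
  intro v₁ h₁ v₂ h₂ h
  simp only [CNF.vars, Finset.mem_coe, List.mem_toFinset] at h₁ h₂
  by_contra hne
  rcases Nat.lt_or_gt_of_ne hne with hlt | hgt
  · exact absurd h (countP_lt_lt_countP_lt hlt h₁).ne
  · exact absurd h (countP_lt_lt_countP_lt hgt h₂).ne'

/-- `foldr max 0` is bounded by a bound on the members. [folklore] -/
theorem foldr_max_le {l : List ℕ} {B : ℕ} (h : ∀ x ∈ l, x ≤ B) : l.foldr max 0 ≤ B := by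
  induction l with
  | nil => exact Nat.zero_le _
  | cons a l ih =>
    rw [List.foldr_cons]
    exact max_le (h a List.mem_cons_self) (ih fun x hx => h x (List.mem_cons_of_mem _ hx))

/-- A CNF code is longer than four times the number of literal occurrences. [folklore] -/
theorem four_mul_length_flatten_le (ψ : CNF ℕ) : 4 * ψ.flatten.length + 2 ≤ (encodingCNF.encode ψ).length := by
  rw [SharpSATVerif.encode_cnf, length_boolPair, length_encList, List.length_flatten, List.map_map]
  have : ∀ c : Clause ℕ, 4 * c.length ≤ 2 * (encodingClause.encode c).length + 2 := fun c => by
    rw [SharpSATVerif.encode_clause, length_boolPair,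
      show (unaryEncodeNat c.length).length = c.length from unary_decode_encode_nat _]
    omega
  have hsum : 4 * (ψ.map List.length).sum ≤ (ψ.map ((fun a => 2 * a.length + 2) ∘ encodingClause.encode)).sum := by
    induction ψ with
    | nil => simp
    | cons c ψ ih =>
      simp only [List.map_cons, List.sum_cons, Function.comp_apply] at ih ⊢
      have := this c
      omega
  omega

/-- **The renamed formula is compactly indexed**: `numVars (rename φ) ≤ |encode (rename φ)|` (every new
name is at most the number of literal occurrences, and the code is longer than that).
[cite: AroraBarakCC2009, §0.1] -/
theorem numVars_rename_le (φ : CNF ℕ) :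
    (CNF.rename (fun v => (φ.flatten.map Prod.fst).countP (· < v)) φ).numVars ≤
      (encodingCNF.encode (CNF.rename (fun v => (φ.flatten.map Prod.fst).countP (· < v)) φ)).length := by
  refine le_trans ?_ (four_mul_length_flatten_le _)
  refine (foldr_max_le (B := φ.flatten.length + 1) fun x hx => ?_).trans ?_
  · obtain ⟨l, hl, rfl⟩ := List.mem_map.1 hx
    obtain ⟨c, hc, hlc⟩ := List.mem_flatten.1 hl
    obtain ⟨c₀, -, rfl⟩ := List.mem_map.1 hc
    obtain ⟨l₀, -, rfl⟩ := List.mem_map.1 hlc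
    have := List.countP_le_length (p := fun x => decide (x < l₀.1)) (l := φ.flatten.map Prod.fst)
    rw [List.length_map] at this
    change (φ.flatten.map Prod.fst).countP (· < l₀.1) + 1 ≤ _
    omega
  · have : (CNF.rename (fun v => (φ.flatten.map Prod.fst).countP (· < v)) φ).flatten.length = φ.flatten.length := by
      simp only [CNF.rename, List.length_flatten, List.map_map]
      congr 1
      exact List.map_congr_left fun c _ => by simp
    omega

/-- **The renamed formula is satisfiable iff the original is.** [folklore] -/
theorem satisfiable_rename_iff' (φ : CNF ℕ) :
    (CNF.rename (fun v => (φ.flatten.map Prod.fst).countP (· < v)) φ).Satisfiable ↔ φ.Satisfiable :=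
  CNF.satisfiable_rename_iff φ (countRename_injOn φ)

/-! ### The support of `μ_φ` on a satisfiable formula -/

/-- On a satisfiable `ψ`, the set of satisfying strings of length `numVars ψ` is finite and nonempty, so
`μ_ψ` gives it mass `1`: `#(S ∩ S) / #S = 1`. [folklore] -/
theorem ncard_div_self_eq_one {ψ : CNF ℕ} (hsat : ψ.Satisfiable) :
    (({y : List Bool | y.length = ψ.numVars ∧ ψ.eval (fun i => y.getD i false) = true} ∩
        {y : List Bool | y.length = ψ.numVars ∧ ψ.eval (fun i => y.getD i false) = true}).ncard : ℝ) /
      ({y : List Bool | y.length = ψ.numVars ∧ ψ.eval (fun i => y.getD i false) = true}.ncard : ℝ) = 1 := by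
  set S := {y : List Bool | y.length = ψ.numVars ∧ ψ.eval (fun i => y.getD i false) = true} with hS
  have hfin : S.Finite :=
    (Set.finite_range (List.Vector.toList : List.Vector Bool ψ.numVars → List Bool)).subset
      fun y hy => ⟨⟨y, hy.1⟩, rfl⟩
  have hne : S.Nonempty := by
    obtain ⟨σ, hσ⟩ := hsat
    refine ⟨List.ofFn fun i : Fin ψ.numVars => σ i, List.length_ofFn, ?_⟩
    rw [← hσ]
    refine CNF.eval_congr fun x hx => ?_
    simp only [CNF.vars, List.mem_toFinset, List.mem_map, List.mem_flatten] at hx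
    obtain ⟨l, ⟨c, hc, hl⟩, rfl⟩ := hx
    have hlt := CNF.lt_numVars_of_mem_of_mem hc hl
    rw [List.getD_eq_getElem _ _ (by simpa using hlt), List.getElem_ofFn]
  rw [Set.inter_self, div_self]
  exact_mod_cast ((Set.ncard_pos hfin).2 hne).ne'

/-! ### `SAT ∈ RP` from a witness forger -/

/-- **A `1/4`-forger of the uniform measure on SAT witnesses puts `SAT` in `RP`.** Let `A` be a
probabilistic polynomial-time algorithm whose output law on the code of every satisfiable compactly
indexed CNF `φ` is within `1/4` of `μ_φ` on every event. The witness language `L' ∈ P` accepts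
`⟨x, r⟩` iff for SOME `j < |⟨x, r⟩|` the string `x` is a CNF codeword and the output
`A(C x, r ↾ j)` strictly satisfies the compacted code `C x` (`exists_compactFn` after the canonicaliser
`canonCNFFn`; test `exists_satTestFn`; the bounded existential by `Brick.ballLen_mem_P` and `P = coP`).
No false positives: an accepted coin string exhibits a satisfying assignment of the compacted, hence of
the original formula. Completeness: for the (possibly non-computable, polynomially bounded) coin budget
`m = coinLen |C x| ≤ q(|x|)`, the prefix `r ↾ m` of a uniform `r ∈ {0,1}^{q(|x|)}` is uniform
(cylinder lemma), and `A` hits the support of `μ_{C x}` — strings of length `numVars` satisfying the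
formula, on which the strict test agrees with `CNF.eval` — with probability `≥ μ(support) - 1/4 = 3/4`.
[cite: Goldreich2001FoC1, §2.7.3; AroraBarakCC2009, Def. 7.6 and §7.1] -/
theorem SAT_mem_RP_of_forger (A : RandAlg (List Bool) (List Bool)) (hA : A.IsPolyTime id id)
    (hforge : ∀ φ : CNF ℕ, φ.Satisfiable → φ.numVars ≤ (encodingCNF.encode φ).length →
      ∀ E : Set (List Bool), |A.pr id (encodingCNF.encode φ) E -
        (({y : List Bool | y.length = φ.numVars ∧ φ.eval (fun i => y.getD i false) = true} ∩ E).ncard : ℝ) /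
        ({y : List Bool | y.length = φ.numVars ∧ φ.eval (fun i => y.getD i false) = true}.ncard : ℝ)| ≤ 1 / 4) :
    SAT ∈ RP := by
  classical
  obtain ⟨hrun, pc, hpc⟩ := hA
  -- the run map behind the unpairing normaliser
  set g : List Bool → List Bool := Function.uncurry A.run ∘ boolUnpair with hg
  have hgFP : g ∈ FP := PolyTimeComputable.comp_holds hrun polyTimeComputable_boolUnpair
  obtain ⟨V, hV, h1V, hVspec⟩ := exists_satTestFn
  obtain ⟨F, hF, hFspec⟩ := exists_compactFn
  -- the compaction of an arbitrary string: canonicalise, then rename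
  set C : List Bool → List Bool := F ∘ KSATRed.canonCNFFn with hC
  have hCFP : C ∈ FP := comp_mem_FP hF KSATRed.canonCNFFn_mem_FP
  have hCval : ∀ x, C x = encodingCNF.encode (CNF.rename
      (fun v => ((NegCNF.decCNF x).flatten.map Prod.fst).countP (· < v)) (NegCNF.decCNF x)) := fun x => by
    simp only [hC, Function.comp_apply, KSATRed.canonCNFFn_eq, hFspec]
  obtain ⟨s, hs⟩ := exists_poly_length_le_of_mem_FP hCFP
  -- the one-bit test on `⟨⟨x, r⟩, u⟩`: `x` is a codeword and `A(C x, r ↾ |u|)` strictly satisfies `C x`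
  set T : List Bool → List Bool :=
    andFn (eqPairFn ∘ fanoutFn (KSATRed.canonCNFFn ∘ fstF ∘ fstF) (fstF ∘ fstF))
      (V ∘ fanoutFn (C ∘ fstF ∘ fstF) (g ∘ fanoutFn (C ∘ fstF ∘ fstF)
        (Plumb.takeFn ∘ fanoutFn sndF (sndF ∘ fstF)))) with hT
  have hTFP : T ∈ FP :=
    andFn_mem_FP (comp_mem_FP eqPairFn_mem_FP (fanoutFn_mem_FP
        (comp_mem_FP KSATRed.canonCNFFn_mem_FP (comp_mem_FP fstF_mem_FP fstF_mem_FP))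
        (comp_mem_FP fstF_mem_FP fstF_mem_FP)))
      (comp_mem_FP hV (fanoutFn_mem_FP (comp_mem_FP hCFP (comp_mem_FP fstF_mem_FP fstF_mem_FP))
        (comp_mem_FP hgFP (fanoutFn_mem_FP (comp_mem_FP hCFP (comp_mem_FP fstF_mem_FP fstF_mem_FP))
          (comp_mem_FP Plumb.takeFn_mem_FP (fanoutFn_mem_FP sndF_mem_FP (comp_mem_FP sndF_mem_FP fstF_mem_FP)))))))
  have h1T : OneBit T := oneBit_andFn (oneBit_eqPairFn.comp _) (h1V.comp _)
  have hTval : ∀ x r u : List Bool, T (boolPair (boolPair x r) u) = [true] ↔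
      KSATRed.canonCNFFn x = x ∧ V (boolPair (C x) (A.run (C x) (r.take u.length))) = [true] := by
    intro x r u
    obtain ⟨b, hb⟩ := h1V (boolPair (C x) (A.run (C x) (r.take u.length)))
    have h1 : (eqPairFn ∘ fanoutFn (KSATRed.canonCNFFn ∘ fstF ∘ fstF) (fstF ∘ fstF))
        (boolPair (boolPair x r) u) = [decide (KSATRed.canonCNFFn x = x)] := by
      simp only [Function.comp_apply, fanoutFn_apply, fstF_boolPair, eqPairFn_boolPair]
    have h2 : (V ∘ fanoutFn (C ∘ fstF ∘ fstF) (g ∘ fanoutFn (C ∘ fstF ∘ fstF)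
        (Plumb.takeFn ∘ fanoutFn sndF (sndF ∘ fstF)))) (boolPair (boolPair x r) u) = [b] := by
      simp only [Function.comp_apply, fanoutFn_apply, fstF_boolPair, sndF_boolPair, Plumb.takeFn_boolPair, hg,
        boolUnpair_boolPair, Function.uncurry_apply_pair]
      exact hb
    rw [hT, andFn_apply h1 h2, hb]
    cases b <;> simp
  -- the witness language: some prefix of the coins is accepted
  set Tl : Language Bool := {z | T z = [true]} with hTl
  have hTlP : Tl ∈ Classes.P := mem_P_of_mem_FP hTFP Tl fun w => ⟨fun h => h, fun h => by
    obtain ⟨b, hb⟩ := h1T w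
    cases b
    · exact hb
    · exact absurd hb h⟩
  set L' : Language Bool := {w | ∀ j < w.length, boolPair w (ones j) ∈ Tlᶜ}ᶜ with hL'
  have hL'P : L' ∈ Classes.P := compl_mem_P_iff.2 (ballLen_mem_P (compl_mem_P_iff.2 hTlP))
  have hmemL' : ∀ w, w ∈ L' ↔ ∃ j < w.length, T (boolPair w (ones j)) = [true] := fun w => by
    change ¬ (∀ j < w.length, ¬ T (boolPair w (ones j)) = [true]) ↔ _
    simp only [not_forall, not_not, exists_prop]
  refine ⟨L', hL'P, pc.comp s, fun x => ⟨fun hx => ?_, fun hx r _ hr => ?_⟩⟩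
  · -- completeness: `x = encode φ` with `φ` satisfiable
    obtain ⟨φ, hφ, rfl⟩ := hx
    have hdec : NegCNF.decCNF (encodingCNF.encode φ) = φ :=
      Option.some.inj ((NegCNF.decode_cnf _).symm.trans (encodingCNF.decode_encode φ))
    set ψ := CNF.rename (fun v => (φ.flatten.map Prod.fst).countP (· < v)) φ with hψ
    have hCx : C (encodingCNF.encode φ) = encodingCNF.encode ψ := by rw [hCval, hdec]
    have hψsat : ψ.Satisfiable := (satisfiable_rename_iff' φ).2 hφ
    set S := {y : List Bool | y.length = ψ.numVars ∧ ψ.eval (fun i => y.getD i false) = true} with hS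
    have hpr : 3 / 4 ≤ uniformProb (A.coinLen (encodingCNF.encode ψ).length)
        {c | A.run (encodingCNF.encode ψ) c ∈ S} := by
      have h := hforge ψ hψsat (numVars_rename_le φ) S
      rw [ncard_div_self_eq_one hψsat, abs_sub_le_iff, RandAlg.pr_eq_uniformProb] at h
      change _ ∧ 1 - uniformProb (A.coinLen (encodingCNF.encode ψ).length) _ ≤ 1 / 4 at h
      linarith [h.2]
    have hmq : A.coinLen (encodingCNF.encode ψ).length ≤ (pc.comp s).eval (encodingCNF.encode φ).length := by
      rw [eval_comp]
      refine (hpc _).trans (TM2Iter.eval_mono pc ?_)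
      rw [← hCx]
      exact hs _
    rw [← uniformProb_take_of_le hmq] at hpr
    refine le_trans (by norm_num) (hpr.trans (BlockRejection.uniformProb_mono_len fun r hr hrS => ?_))
    obtain ⟨hlen, heval⟩ : A.run (encodingCNF.encode ψ) (r.take (A.coinLen (encodingCNF.encode ψ).length)) ∈ S := hrS
    change boolPair (encodingCNF.encode φ) r ∈ L'
    rw [hmemL']
    refine ⟨A.coinLen (encodingCNF.encode ψ).length, ?_, ?_⟩
    · rw [length_boolPair]; omega
    · rw [hTval, hCx, hVspec]
      refine ⟨by rw [KSATRed.canonCNFFn_eq, hdec], ?_⟩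
      simp only [List.length_replicate]
      rw [decide_eq_true (strictSat_of_eval (fun c hc l hl => hlen ▸ CNF.lt_numVars_of_mem_of_mem hc hl) heval)]
  · -- no false positives: an accepted coin string exhibits a satisfying assignment
    obtain ⟨j, -, hj⟩ := (hmemL' _).1 hr
    obtain ⟨hcode, hVt⟩ := (hTval x r (ones j)).1 hj
    apply hx
    rw [hCval x, hVspec] at hVt
    have hsat := eval_of_strictSat (of_decide_eq_true (List.cons.inj hVt).1)
    rw [← hcode, KSATRed.canonCNFFn_eq]
    exact (mem_SAT_iff _).2 ((satisfiable_rename_iff' _).1 ⟨_, hsat⟩)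

end CalibrationSatBPP

open Literature.Computability.Complexity in
/-- **Calibration of the witness-forging thesis from below: `SAT ∉ BPP → ForgingThesis`**
(support item stmt-PneNP-2437 of route `PneNP/WitnessForging`). Contrapositive: if the thesis fails,
some probabilistic polynomial-time `A` `1/4`-forges `μ_φ` on every satisfiable compactly indexed `φ`;
compacting the variable indices of the input, running `A` and accepting iff the output satisfies the
formula is a one-sided-error polynomial-time test (`SAT_mem_RP_of_forger`), so `SAT ∈ RP ⊆ BPP`
(`RP_subset_BPP_holds`). [cite: Goldreich2001FoC1, §2.7.3; AroraBarakCC2009, §7.3] -/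
theorem CalibrationSatBPP_proof : Summit.PneNP.PneNP.Theses.WitnessForging.CalibrationSatBPP := by
  unfold Summit.PneNP.PneNP.Theses.WitnessForging.CalibrationSatBPP
  intro hSAT
  by_contra hX
  unfold Summit.PneNP.PneNP.Theses.WitnessForging.ForgingThesis at hX
  push Not at hX
  obtain ⟨A, hA, hgood⟩ := hX
  exact hSAT (RP_subset_BPP_holds (CalibrationSatBPP.SAT_mem_RP_of_forger A hA hgood))

end Summit.PneNP.PneNP.Theorems
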